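import Summits.AtomisticToContinuum.Crystallization.Theses.PalmUnimodularRigidity
import Summits.AtomisticToContinuum.Crystallization.Theorems.MinimiserShells.Negative.LoadBearing
import Summits.AtomisticToContinuum.Crystallization.Theorems.MinimiserShells.Negative.Rootedness
import Summits.AtomisticToContinuum.Crystallization.Theorems.ChargedEnergyGap.Negative.PeriodicFormConverse
import Summits.AtomisticToContinuum.Crystallization.Theorems.PalmUnimodularRigidityMinimiserShellsDeepBadPricingOfShellNoBoundary
import Summits.AtomisticToContinuum.Crystallization.Theorems.PalmUnimodularRigidityLayeredLawsSelectHcpPeriodicMuGSC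

/-!
# The qualitative no-boundary shell gap gives the periodic shell gap (stub S14, reshape r5)

Stub `stub_periodicShellGap_of_qualShellNoBoundary` (S14) of line `equilibrium-in-law-surgery` (reshape r5) of
crux `MinimiserShells` (stmt-AtomisticToContinuum-9225, route `PalmUnimodularRigidity`).

If the QUALITATIVE particle-level no-boundary shell gap holds — for every threshold `t > 0` some `κ > 0`
such that every finite injective configuration `y : Fin N → ℝ³` with at least `t · N` badly-shelled sites
(`¬ GoodShell (count|((· - yᵢ) '' range y))`) has `N · (e* + κ) ≤ 𝓔_N(y)` — then the PERIODIC shell gap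
holds: for every `t > 0` some `κ > 0` (the finite one at threshold `t/2`) such that every periodic
configuration `Q` of `ℝ³` with at least `t · #motif` motif sites badly shelled in the infinite point set
`Q.points` has `e* + κ ≤ e(Q)`.

Proof (blocks, after `ChargedEnergyGapNegative.Blocks.periodicPricing_of_noBoundary`).  Fix `Q` with
`t · #F ≤ #bad motif` and `ε > 0`; it suffices to show `e* + κ ≤ e(Q) + ε`.  The `K³`-blocks
`blockConfig Q K : Fin (#F·K³) → ℝ³` of `Q` (`ChargedEnergyGap/Negative/BlocksEnergy`) are injective and have
energy `≤ #F·K³·(e(Q) + ε)` for `K ≥ K₀(ε)` (`Blocks.exists_block_energy_le`).  A block point `x + g`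
(`g` a period) sees the re-rooted point set `(· - (x + g)) '' Q.points = (· - x) '' Q.points` (lattice
invariance), and if its lattice coordinates are `depth Q 2`-deep every point of `Q` within distance `< 2`
of it is a block point (`Blocks.exists_eq_toP_of_dist_lt`; `LayeredLawsSelectHcp.range_blockConfig_subset`,
`bpt_mem_range_blockConfig` identify the range of the block); since the shell predicate reads only the closed
ball `B̄(·, 5/4)` (`ShellNoBoundary.goodShell_count_restrict_image_sub_congr`, `R₀ = 3/2`), such a block
point is badly shelled in the block iff `x` is badly shelled in `Q.points`.  All but `≤ 6·depth·K²`
coordinates are deep (`Blocks.card_deep_ge`), so for `K ≥ 12·depth` the block has at least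
`(K³ − 6·depth·K²) · t · #F ≥ (t/2) · #F·K³` badly-shelled sites, and the finite gap at threshold `t/2`
gives `#F·K³ · (e* + κ) ≤ 𝓔(block) ≤ #F·K³ · (e(Q) + ε)`.
-/

noncomputable section

open MeasureTheory
open scoped ENNReal BigOperators Classical

namespace Summit.AtomisticToContinuum.Crystallization.Theorems.PalmUnimodularRigidityMinimiserShells.PeriodicShellGapConverse

open Literature.MathematicalPhysics.StatisticalMechanics (lennardJones interactionEnergy PeriodicConfiguration)
open Summit.AtomisticToContinuum.Crystallization.Theorems.MinimiserShells.Negative.LoadBearing (eStar GoodShell)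
open Summit.AtomisticToContinuum.Crystallization.Theorems.MinimiserShells.Negative.Rootedness (E3)
open Summit.AtomisticToContinuum.Crystallization.Theorems.PalmUnimodularRigidityMinimiserShells.ShellNoBoundary
  (goodShell_count_restrict_image_sub_congr)
open Summit.AtomisticToContinuum.Crystallization.Theorems.ChargedEnergyGapNegative.Blocks
  (BIdx bpt card_BIdx blockConfig blockConfig_apply blockConfig_injective toP
   IsDeep depth exists_eq_toP_of_dist_lt exists_block_energy_le card_deep_ge latVec latVec_mem coords)
open Summit.AtomisticToContinuum.Crystallization.Theorems.PalmUnimodularRigidity.LayeredLawsSelectHcp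
  (range_blockConfig_subset bpt_mem_range_blockConfig)

variable (Q : PeriodicConfiguration 3) (K : ℕ)

/-! ## Shells of block points -/

/-- **Lattice invariance of the re-rooted point set.**  Re-rooting `Q.points` at the block point
`x + g` (`g = latVec Q (coords K k)` a period) gives the same set as re-rooting at the motif point `x`:
`(· - (x + g)) '' Q.points = (· - x) '' Q.points`. -/
theorem image_sub_bpt_points (u : BIdx Q K) :
    (fun z => z - bpt Q K u) '' Q.points = (fun z => z - (u.1 : E3)) '' Q.points := by
  ext w
  simp only [Set.mem_image]
  constructor
  · rintro ⟨z, hz, rfl⟩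
    refine ⟨z + -latVec Q (coords K u.2),
      Q.add_mem_points hz (Q.lattice.neg_mem (latVec_mem Q (coords K u.2))), ?_⟩
    simp only [bpt]
    abel
  · rintro ⟨z, hz, rfl⟩
    refine ⟨z + latVec Q (coords K u.2), Q.add_mem_points hz (latVec_mem Q (coords K u.2)), ?_⟩
    simp only [bpt]
    abel

/-- **Deep block points are `3/2`-deep in the block**: if the lattice coordinates of the block point
`u` are `depth Q 2`-deep, every point of `Q` within distance `3/2` of it is a block point
(`Blocks.exists_eq_toP_of_dist_lt`). -/
theorem points_inter_closedBall_subset_range {u : BIdx Q K} (hdeep : IsDeep K (depth Q 2) u.2) :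
    Q.points ∩ Metric.closedBall (bpt Q K u) (3 / 2) ⊆ Set.range (blockConfig Q K) := by
  rintro p ⟨hp, hball⟩
  by_cases hpu : p = bpt Q K u
  · rw [hpu]
    exact bpt_mem_range_blockConfig Q K u
  · have hne : (⟨p, hp⟩ : Q.points) ≠ toP Q K u := fun h => hpu (congrArg Subtype.val h)
    have hlt : dist (bpt Q K u) p < 2 := by
      rw [Metric.mem_closedBall, dist_comm] at hball
      linarith
    obtain ⟨v, -, hv⟩ := exists_eq_toP_of_dist_lt Q K hdeep ⟨p, hp⟩ hne hlt
    have hpv : bpt Q K v = p := congrArg Subtype.val hv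
    rw [← hpv]
    exact bpt_mem_range_blockConfig Q K v

/-- **Deep block points are well shelled in the block iff their motif point is well shelled in `Q`.**
For `depth Q 2`-deep lattice coordinates `k`, the block point `x + latVec (coords k)` is well shelled in
the finite block configuration iff the motif point `x` is well shelled in the infinite point set
`Q.points` (locality of `GoodShell` with `R₀ = 3/2`, and lattice invariance). -/
theorem goodShell_block_iff (x : Q.motif) {k : Fin 3 → Fin K} (hdeep : IsDeep K (depth Q 2) k) :
    GoodShell ((Measure.count : Measure E3).restrict
        ((fun z => z - bpt Q K (x, k)) '' Set.range (blockConfig Q K))) ↔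
      GoodShell ((Measure.count : Measure E3).restrict ((fun z => z - (x : E3)) '' Q.points)) := by
  rw [← image_sub_bpt_points Q K (x, k)]
  exact (goodShell_count_restrict_image_sub_congr (range_blockConfig_subset Q K)
    (by norm_num : (5 : ℝ) / 4 ≤ 3 / 2)
    (points_inter_closedBall_subset_range Q K (u := (x, k)) hdeep)).symm

/-! ## Counting badly-shelled block points -/

/-- **Deep coordinates × badly-shelled motif sites inject into the badly-shelled block indices**:
`#{k deep} · #{x ∈ F badly shelled in Q.points} ≤ #{a badly shelled in the block}`
(`(k, x) ↦ equivFin (x, k)`, `goodShell_block_iff`). -/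
theorem card_bad_block_ge :
    Nat.card {k : Fin 3 → Fin K // IsDeep K (depth Q 2) k} *
        Nat.card {x : Q.motif // ¬ GoodShell ((Measure.count : Measure E3).restrict
          ((fun z => z - (x : E3)) '' Q.points))} ≤
      Nat.card {a : Fin (Fintype.card (BIdx Q K)) // ¬ GoodShell ((Measure.count : Measure E3).restrict
          ((fun z => z - blockConfig Q K a) '' Set.range (blockConfig Q K)))} := by
  let f : {k : Fin 3 → Fin K // IsDeep K (depth Q 2) k} ×
      {x : Q.motif // ¬ GoodShell ((Measure.count : Measure E3).restrict
          ((fun z => z - (x : E3)) '' Q.points))} →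
      {a : Fin (Fintype.card (BIdx Q K)) // ¬ GoodShell ((Measure.count : Measure E3).restrict
          ((fun z => z - blockConfig Q K a) '' Set.range (blockConfig Q K)))} :=
    fun p => ⟨Fintype.equivFin (BIdx Q K) (p.2.1, p.1.1), by
      rw [blockConfig_apply, Equiv.symm_apply_apply, goodShell_block_iff Q K p.2.1 p.1.2]
      exact p.2.2⟩
  have hf : Function.Injective f := by
    rintro ⟨⟨k, hk⟩, ⟨x, hx⟩⟩ ⟨⟨k', hk'⟩, ⟨x', hx'⟩⟩ h
    have h' : Fintype.equivFin (BIdx Q K) (x, k) = Fintype.equivFin (BIdx Q K) (x', k') :=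
      congrArg Subtype.val h
    obtain ⟨rfl, rfl⟩ := Prod.ext_iff.1 ((Fintype.equivFin (BIdx Q K)).injective h')
    rfl
  have := Nat.card_le_card_of_injective f hf
  rwa [Nat.card_prod] at this

/-! ## The stub -/

/-- **Stub `stub_periodicShellGap_of_qualShellNoBoundary` (S14) of line `equilibrium-in-law-surgery`.**
The qualitative particle-level no-boundary shell gap (finite injective configurations with at least
`t · N` badly-shelled sites have `N · (e* + κ) ≤ 𝓔_N`) implies the periodic shell gap (periodic
configurations with at least `t · #motif` motif sites badly shelled in `Q.points` have `e* + κ ≤ e(Q)`),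
with the finite `κ` of threshold `t/2`: the `K³`-blocks of `Q` are trial states
(`Blocks.exists_block_energy_le`), their deep block points are badly shelled in the block iff their motif
point is badly shelled in `Q` (`goodShell_block_iff`), so they have `≥ (K³ − 6·depth·K²)·t·#F ≥ (t/2)·#F·K³`
badly-shelled sites (`card_bad_block_ge`, `Blocks.card_deep_ge`), and the finite gap gives
`e* + κ ≤ e(Q) + ε` for every `ε > 0`. -/
theorem stub_periodicShellGap_of_qualShellNoBoundary :
    (∀ t : ℝ, 0 < t → ∃ κ : ℝ, 0 < κ ∧ ∀ (N : ℕ) (y : Fin N → EuclideanSpace ℝ (Fin 3)), Function.Injective y →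
      t * (N : ℝ) ≤ (Nat.card {i : Fin N // ¬ GoodShell
          ((Measure.count : Measure (EuclideanSpace ℝ (Fin 3))).restrict ((fun z => z - y i) '' Set.range y))} : ℝ) →
      (N : ℝ) * (eStar + κ) ≤ interactionEnergy lennardJones y) →
    ∀ t : ℝ, 0 < t → ∃ κ : ℝ, 0 < κ ∧
      ∀ Q : Literature.MathematicalPhysics.StatisticalMechanics.PeriodicConfiguration 3,
        t * (Q.motif.card : ℝ) ≤ (Nat.card {x : Q.motif // ¬ GoodShell
            ((Measure.count : Measure (EuclideanSpace ℝ (Fin 3))).restrict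
              ((fun z => z - (x : EuclideanSpace ℝ (Fin 3))) '' Q.points))} : ℝ) →
        eStar + κ ≤ Q.energyPerParticle lennardJones := by
  intro hfin t ht
  obtain ⟨κ, hκ, hgap⟩ := hfin (t / 2) (half_pos ht)
  refine ⟨κ, hκ, fun Q hbad => le_of_forall_pos_le_add fun ε hε => ?_⟩
  have hF : (0 : ℝ) < Q.motif.card := by exact_mod_cast Q.motif_nonempty.card_pos
  -- blocks are trial states with slack `ε` per particle
  obtain ⟨K₀, hK₀, hK⟩ := exists_block_energy_le Q hε
  -- a large `K`: beyond `K₀` and beyond `12 · depth`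
  set d := depth Q 2
  set K := max K₀ (12 * d)
  have hKK₀ : K₀ ≤ K := le_max_left _ _
  have hK12 : 12 * d ≤ K := le_max_right _ _
  have hKpos : (0 : ℝ) < K := by exact_mod_cast lt_of_lt_of_le hK₀ hKK₀
  have hK12r : 12 * (d : ℝ) ≤ K := by exact_mod_cast hK12
  have hn : ((Fintype.card (BIdx Q K) : ℕ) : ℝ) = Q.motif.card * (K : ℝ) ^ 3 := by
    exact_mod_cast card_BIdx Q K
  -- the energy of the block
  have hE := hK K hKK₀
  rw [hn] at hE
  -- badly-shelled block points: at least `(K³ − 6·d·K²) · t · #F ≥ (t/2) · #F · K³`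
  have hcnt := card_bad_block_ge Q K
  have hdeep := card_deep_ge K d
  set D := Nat.card {k : Fin 3 → Fin K // IsDeep K d k}
  set M := Nat.card {x : Q.motif // ¬ GoodShell ((Measure.count : Measure E3).restrict
    ((fun z => z - (x : E3)) '' Q.points))}
  set B := Nat.card {a : Fin (Fintype.card (BIdx Q K)) // ¬ GoodShell ((Measure.count : Measure E3).restrict
    ((fun z => z - blockConfig Q K a) '' Set.range (blockConfig Q K)))}
  have h1 : (K : ℝ) ^ 3 - 6 * (d : ℝ) * (K : ℝ) ^ 2 ≤ (D : ℝ) := by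
    have := (Nat.cast_le (α := ℝ)).2 hdeep
    push_cast at this
    linarith
  have h2 : (D : ℝ) * (M : ℝ) ≤ (B : ℝ) := by exact_mod_cast hcnt
  have hM0 : (0 : ℝ) ≤ M := Nat.cast_nonneg _
  have hhalf : 6 * (d : ℝ) * (K : ℝ) ^ 2 ≤ (K : ℝ) ^ 3 / 2 := by
    have h := mul_le_mul_of_nonneg_right hK12r (sq_nonneg (K : ℝ))
    have e : (K : ℝ) * (K : ℝ) ^ 2 = (K : ℝ) ^ 3 := by ring
    rw [e] at h
    linarith
  have hMK : t * (Q.motif.card : ℝ) * ((K : ℝ) ^ 3 / 2) ≤ (M : ℝ) * ((K : ℝ) ^ 3 / 2) :=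
    mul_le_mul_of_nonneg_right hbad (div_nonneg (pow_nonneg hKpos.le 3) zero_le_two)
  have hMD : (M : ℝ) * ((K : ℝ) ^ 3 / 2) ≤ (M : ℝ) * (D : ℝ) :=
    mul_le_mul_of_nonneg_left (by linarith) hM0
  have hthr : t / 2 * (Q.motif.card * (K : ℝ) ^ 3) ≤ (B : ℝ) := by
    calc t / 2 * (Q.motif.card * (K : ℝ) ^ 3) = t * (Q.motif.card : ℝ) * ((K : ℝ) ^ 3 / 2) := by ring
      _ ≤ (M : ℝ) * ((K : ℝ) ^ 3 / 2) := hMK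
      _ ≤ (M : ℝ) * (D : ℝ) := hMD
      _ = (D : ℝ) * (M : ℝ) := mul_comm _ _
      _ ≤ (B : ℝ) := h2
  -- the finite gap on the block
  have hg := hgap _ (blockConfig Q K) (blockConfig_injective Q K)
  rw [hn] at hg
  have key := (hg hthr).trans hE
  have hK3 : (0 : ℝ) < Q.motif.card * (K : ℝ) ^ 3 := mul_pos hF (pow_pos hKpos 3)
  exact le_of_mul_le_mul_left key hK3

end Summit.AtomisticToContinuum.Crystallization.Theorems.PalmUnimodularRigidityMinimiserShells.PeriodicShellGapConverse

end
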